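import Summits.MatrixMultiplication.MatrixMultiplication.Theorems.FarEdgeDescentSignTwistComm
import Summits.MatrixMultiplication.MatrixMultiplication.Theorems.FarEdgeDescentTwistDetClass
import HarnessLib

/-!
# `(𝔖^♭)^{⊠N} ⋭ (𝔖^♭ᵀ)^{⊠N}` for every `N ≥ 1`: the `y`-pencil commutant of Kronecker powers

Route `FarEdgeDescent` (cell `decomp-mm`, lens 2 «structural dichotomy (special vs generic)»,
gen 32), Kernel VII-6; support for the aside `SubLogRate` (stmt-MatrixMultiplication-25371).

`FarEdgeDescentSignTwistComm` separates the sign twists at `N = 1` by the commutant of the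
`y`-pencil: two independent intertwiners for `𝔖^♭`, only scalars for `𝔖^♭ᵀ`.  Here the same
obstruction is shown to TENSORISE, over every field: the `y`-pencil of `(𝔖^♭ᵀ)^{⊠N}` — the
Kronecker powers `∏ᵢ 𝔖^♭ᵀ(aᵢ, xᵢ, cᵢ)` of four signed partial permutation matrices — still has
only the scalar intertwiners (`comm_signTStar_pow`), while `(𝔖^♭)^{⊠N}` has the `2^N`
independent row-pattern projections (`βP`, `hcomm_signStar_pow`).  The proof is combinatorial
and coordinatewise: a closed form `𝔖^♭ᵀ(a, x, c) = [side a = side c ∧ x = bOf a c] · wt a c`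
(`signTStar_apply`), a separating choice of `(a, c)` per coordinate (`sepAC`) forcing `β'`
diagonal, injectivity of `a ↦ bOf a c` forcing `γ'` diagonal, and a two-step walk
`(p,q) → (p,0) → (0,0)` in each coordinate equalising the diagonal constants.  Consequence
(`signStar_pow_not_algDegeneratesTo_signTStar_pow`): no Kronecker power of `𝔖^♭` degenerates to
the same power of `𝔖^♭ᵀ`, over any field; with `…SignTwistCore` (`𝔖^ᵀ`-powers versus
`𝔖^♭, 𝔖^♭ᵀ`-powers) and `…TwistRigidity` / `…SignTwist` (`⟨2,2,2⟩`-powers versus all three)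
this makes six of the twelve antichain edges of `FarEdgeDescentGenericAntichain` hold at EVERY
finite level `N`.

References: P. Bürgisser, M. Clausen, M. A. Shokrollahi, *Algebraic Complexity Theory* (1997),
(15.19), §20.2 [BurgisserClausenShokrollahi1997]; H. Cohn, C. Umans, SODA 2013, §3
[CohnUmans2013]; M. Bläser, M. Christandl, J. Zuiddam, arXiv:1705.09652, Def. 5
[BlaserChristandlZuiddam2017].
-/

noncomputable section

open scoped BigOperators

set_option linter.dupNamespace false

namespace Summit.MatrixMultiplication.MatrixMultiplication.Theorems.FarEdgeDescentSignTwistCommPow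

open Literature.Computability.AlgebraicComplexity
open Summit.MatrixMultiplication.MatrixMultiplication.Theorems.FarEdgeDescentCommutantObstruction
open Summit.MatrixMultiplication.MatrixMultiplication.Theorems.FarEdgeDescentSignTwist
open Summit.MatrixMultiplication.MatrixMultiplication.Theorems.FarEdgeDescentSignTwistComm
open Summit.MatrixMultiplication.MatrixMultiplication.Theorems.FarEdgeDescentSignTwistDet
open Summit.MatrixMultiplication.MatrixMultiplication.Theorems.FarEdgeDescentTwistedStar

universe u

/-! ## A closed form for `𝔖^♭ᵀ` -/

section ClosedForm
variable (K : Type u) [Field K]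

/-- The side (`L = 0`, `R = 1`) of a leaf index. [folklore] -/
def side : Leaf2 → Fin 2 := Sum.elim (fun _ => 0) (fun _ => 1)

/-- The unique `x`-position carrying `𝔖^♭ᵀ(a, ·, c)` (for `side a = side c`). [folklore] -/
def bOf : Leaf2 → Leaf2 → Fin 2 × Fin 2
  | Sum.inl z, Sum.inl w => (z.1, w.1)
  | Sum.inr z, Sum.inr w => (w.1, z.1)
  | Sum.inl z, Sum.inr w => (z.1, w.1)
  | Sum.inr z, Sum.inl w => (z.1, w.1)

/-- The value of `𝔖^♭ᵀ(a, bOf a c, c)`. [folklore] -/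
def wt : Leaf2 → Leaf2 → K
  | Sum.inr z, Sum.inr w => sgnWeight K (w.1, z.1)
  | _, _ => 1

/-- `wt` never vanishes. [folklore] -/
theorem wt_ne_zero (a c : Leaf2) : wt K a c ≠ 0 := by
  rcases a with z | z <;> rcases c with w | w <;> simp [wt, sgnWeight_ne_zero]

/-- **Closed form**: `𝔖^♭ᵀ(a, x, c) = [side a = side c ∧ x = bOf a c] · wt a c`. [folklore] -/
theorem signTStar_apply (a : Leaf2) (x : Fin 2 × Fin 2) (c : Leaf2) :
    signTStar K a x c = if side a = side c ∧ x = bOf a c then wt K a c else 0 := by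
  rcases a with ⟨i, l⟩ | ⟨i, l⟩ <;> rcases c with ⟨k, l'⟩ | ⟨k, l'⟩
  · rw [signTStar_inl_inl]; simp [side, bOf, wt]
  · simp [side]
  · simp [side]
  · rw [signTStar_inr_inr]; simp [side, bOf, wt]

variable {K}

/-- `a ↦ bOf a c` is injective on the side of `c`. [folklore] -/
theorem eq_of_bOf_eq {a a' c : Leaf2} (ha : side a = side c) (ha' : side a' = side c)
    (h : bOf a c = bOf a' c) : a = a' := by
  rcases a with ⟨i, l⟩ | ⟨i, l⟩ <;> rcases a' with ⟨i', m⟩ | ⟨i', m⟩ <;>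
    rcases c with ⟨k, l'⟩ | ⟨k, l'⟩ <;>
    simp_all [side, bOf, Prod.ext_iff] <;>
    exact Subsingleton.elim _ _

variable (K)

/-- Coordinatewise vanishing of a Kronecker-power entry of `𝔖^♭ᵀ`. [folklore] -/
theorem prod_signTStar_eq_zero {N : ℕ} {a c : Fin N → Leaf2} {x : Fin N → Fin 2 × Fin 2}
    (i : Fin N) (h : ¬ (side (a i) = side (c i) ∧ x i = bOf (a i) (c i))) :
    ∏ j, signTStar K (a j) (x j) (c j) = 0 :=
  Finset.prod_eq_zero (Finset.mem_univ i) (by rw [signTStar_apply, if_neg h])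

/-- The supported Kronecker-power entries of `𝔖^♭ᵀ`. [folklore] -/
theorem prod_signTStar_eq_wt {N : ℕ} {a c : Fin N → Leaf2} {x : Fin N → Fin 2 × Fin 2}
    (h : ∀ j, side (a j) = side (c j) ∧ x j = bOf (a j) (c j)) :
    ∏ j, signTStar K (a j) (x j) (c j) = ∏ j, wt K (a j) (c j) :=
  Finset.prod_congr rfl fun j _ => by rw [signTStar_apply, if_pos (h j)]

/-- The supported entries are nonzero. [folklore] -/
theorem prod_wt_ne_zero {N : ℕ} (a c : Fin N → Leaf2) : ∏ j, wt K (a j) (c j) ≠ 0 :=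
  Finset.prod_ne_zero_iff.mpr fun _ _ => wt_ne_zero K _ _

/-- **Separating coordinates.** For positions `b'' ≠ b`, a pair `(a, c)` with `side a = side c`,
`bOf a c = b''` and `b ∉ D_c` (no `y` with `𝔖^♭ᵀ(y, b, c) ≠ 0`). [folklore] -/
def sepAC (b'' b : Fin 2 × Fin 2) : Leaf2 × Leaf2 :=
  if b.2 ≠ b''.2 then (Sum.inl (b''.1, 0), Sum.inl (b''.2, 0))
  else (Sum.inr (b''.2, 0), Sum.inr (b''.1, 0))

/-- `sepAC` matches sides. [folklore] -/
theorem side_sepAC (b'' b : Fin 2 × Fin 2) : side (sepAC b'' b).1 = side (sepAC b'' b).2 := by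
  unfold sepAC; split_ifs <;> rfl

/-- `sepAC` carries `b''`. [folklore] -/
theorem bOf_sepAC (b'' b : Fin 2 × Fin 2) : bOf (sepAC b'' b).1 (sepAC b'' b).2 = b'' := by
  unfold sepAC; split_ifs <;> rfl

/-- `sepAC` separates `b` from the row support of its slice. [folklore] -/
theorem sepAC_sep {b'' b : Fin 2 × Fin 2} (hne : b ≠ b'') (y : Leaf2) :
    ¬ (side y = side (sepAC b'' b).2 ∧ b = bOf y (sepAC b'' b).2) := by
  rintro ⟨hs, hb⟩
  unfold sepAC at hs hb
  by_cases hq : b.2 ≠ b''.2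
  · rw [if_pos hq] at hs hb
    rcases y with ⟨i, l⟩ | ⟨i, l⟩
    · simp only [bOf] at hb; exact hq (by rw [hb])
    · simp [side] at hs
  · rw [if_neg hq] at hs hb
    have hp : b.1 ≠ b''.1 := fun h => hne (Prod.ext h (not_not.mp hq))
    rcases y with ⟨i, l⟩ | ⟨i, l⟩
    · simp [side] at hs
    · simp only [bOf] at hb; exact hp (by rw [hb])

end ClosedForm

/-! ## The `y`-pencil commutant of `(𝔖^♭ᵀ)^{⊠N}` is scalar -/

section CommT
variable {K : Type u} [Field K] {N : ℕ}
  {β' : Matrix (Fin N → Fin 2 × Fin 2) (Fin N → Fin 2 × Fin 2) K}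
  {γ' : Matrix (Fin N → Leaf2) (Fin N → Leaf2) K}
  (H : ∀ c, β' * slice (kroneckerPow (rot (signTStar K)) N) c =
    slice (kroneckerPow (rot (signTStar K)) N) c * γ')
include H

/-- Entries of the commutation relation. [folklore] -/
theorem entry_eq (c : Fin N → Leaf2) (b : Fin N → Fin 2 × Fin 2) (a : Fin N → Leaf2) :
    ∑ x, β' b x * ∏ i, signTStar K (a i) (x i) (c i) =
      ∑ y, (∏ i, signTStar K (y i) (b i) (c i)) * γ' y a := by
  have h := congr_fun (congr_fun (H c) b) a
  simpa only [Matrix.mul_apply, slice_apply, kroneckerPow_apply, rot_apply] using h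

/-- **Step 1: `β'` is diagonal.** [folklore] -/
theorem β_offdiag {b b'' : Fin N → Fin 2 × Fin 2} (hne : b ≠ b'') : β' b b'' = 0 := by
  obtain ⟨i₀, hi₀⟩ := Function.ne_iff.mp hne
  have h := entry_eq H (fun i => (sepAC (b'' i) (b i)).2) b (fun i => (sepAC (b'' i) (b i)).1)
  rw [Fintype.sum_eq_single b'', prod_signTStar_eq_wt K
      (fun j => ⟨side_sepAC _ _, (bOf_sepAC _ _).symm⟩), Finset.sum_eq_zero] at h
  · exact (mul_eq_zero.mp h).resolve_right (prod_wt_ne_zero K _ _)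
  · intro y _
    rw [prod_signTStar_eq_zero K i₀ (sepAC_sep hi₀ (y i₀)), zero_mul]
  · intro x hx
    obtain ⟨i₁, hi₁⟩ := Function.ne_iff.mp hx
    rw [prod_signTStar_eq_zero K i₁ (fun h' => hi₁ (h'.2.trans (bOf_sepAC _ _))), mul_zero]

/-- **Step 2: the key identity** `β'(b,b) · [a = a⁰] · W = W · γ'(a⁰, a)` for `b = bOf(a⁰, c)`
coordinatewise. [folklore] -/
theorem key_identity (a₀ c : Fin N → Leaf2) (hs : ∀ i, side (a₀ i) = side (c i))
    (a : Fin N → Leaf2) :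
    β' (fun i => bOf (a₀ i) (c i)) (fun i => bOf (a₀ i) (c i)) *
        ∏ i, signTStar K (a i) (bOf (a₀ i) (c i)) (c i) =
      (∏ i, wt K (a₀ i) (c i)) * γ' a₀ a := by
  have h := entry_eq H c (fun i => bOf (a₀ i) (c i)) a
  rw [Fintype.sum_eq_single (fun i => bOf (a₀ i) (c i)), Fintype.sum_eq_single a₀,
    prod_signTStar_eq_wt K (fun j => ⟨hs j, rfl⟩)] at h
  · exact h
  · intro y hy
    obtain ⟨i₁, hi₁⟩ := Function.ne_iff.mp hy
    rw [prod_signTStar_eq_zero K i₁ (fun h' => hi₁ (eq_of_bOf_eq h'.1 (hs i₁) h'.2.symm)),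
      zero_mul]
  · intro x hx
    rw [β_offdiag H (Ne.symm hx), zero_mul]

/-- `γ'` vanishes off the diagonal. [folklore] -/
theorem γ_offdiag {a₀ a : Fin N → Leaf2} (hne : a ≠ a₀) : γ' a₀ a = 0 := by
  have h := key_identity H a₀ a₀ (fun _ => rfl) a
  obtain ⟨i₁, hi₁⟩ := Function.ne_iff.mp hne
  rw [prod_signTStar_eq_zero K i₁ (fun h' => hi₁ (eq_of_bOf_eq h'.1 rfl h'.2.symm)),
    mul_zero] at h
  exact (mul_eq_zero.mp h.symm).resolve_left (prod_wt_ne_zero K _ _)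

/-- Diagonal entries of `γ'` are diagonal entries of `β'`. [folklore] -/
theorem γ_diag (a₀ c : Fin N → Leaf2) (hs : ∀ i, side (a₀ i) = side (c i)) :
    γ' a₀ a₀ = β' (fun i => bOf (a₀ i) (c i)) (fun i => bOf (a₀ i) (c i)) := by
  have h := key_identity H a₀ c hs a₀
  rw [prod_signTStar_eq_wt K (fun j => ⟨hs j, rfl⟩), mul_comm] at h
  exact (mul_left_cancel₀ (prod_wt_ne_zero K _ _) h).symm

/-- **Step 3: all diagonal entries of `β'` agree** (walk `(p,q) → (p,0) → (0,0)` in every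
coordinate). [folklore] -/
theorem β_diag (b : Fin N → Fin 2 × Fin 2) :
    β' b b = β' (fun _ => (0, 0)) (fun _ => (0, 0)) := by
  -- `(p,q) → (p,0)` through `γ'(L_p, L_p)`
  have h1 := γ_diag H (fun i => (Sum.inl ((b i).1, 0) : Leaf2)) (fun i => Sum.inl ((b i).2, 0))
    (fun _ => rfl)
  have h2 := γ_diag H (fun i => (Sum.inl ((b i).1, 0) : Leaf2)) (fun _ => Sum.inl (0, 0))
    (fun _ => rfl)
  -- `(p,0) → (0,0)` through `γ'(R_0, R_0)`
  have h3 := γ_diag H (fun _ => (Sum.inr (0, 0) : Leaf2)) (fun i => Sum.inr ((b i).1, 0))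
    (fun _ => rfl)
  have h4 := γ_diag H (fun _ => (Sum.inr (0, 0) : Leaf2)) (fun _ => Sum.inr (0, 0))
    (fun _ => rfl)
  simp only [bOf, Prod.mk.eta] at h1 h2 h3 h4
  rw [← h1, h2, ← h3, h4]

/-- **The `y`-pencil commutant of `(𝔖^♭ᵀ)^{⊠N}` is scalar.** [folklore] -/
theorem comm_signTStar_pow :
    β' = β' (fun _ => (0, 0)) (fun _ => (0, 0)) • (1 : Matrix _ _ K) ∧
      γ' = β' (fun _ => (0, 0)) (fun _ => (0, 0)) • (1 : Matrix _ _ K) := by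
  constructor
  · ext b x
    by_cases hbx : b = x
    · subst hbx; simp [β_diag H b]
    · simp [hbx, β_offdiag H hbx]
  · ext y a
    by_cases hya : y = a
    · subst hya
      rw [γ_diag H y y (fun _ => rfl), β_diag H]
      simp
    · simp [hya, γ_offdiag H (Ne.symm hya)]

end CommT

/-! ## `2^N` independent intertwiners of the `y`-pencil of `(𝔖^♭)^{⊠N}` -/

section CommS
variable (K : Type u) [Field K] (N : ℕ)

/-- Projection onto the positions with row pattern `r`. [folklore] -/
def βP (r : Fin N → Fin 2) : Matrix (Fin N → Fin 2 × Fin 2) (Fin N → Fin 2 × Fin 2) K :=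
  Matrix.diagonal fun b => if (fun i => (b i).1) = r then 1 else 0

/-- Projection onto the leaf coordinates with row pattern `r`. [folklore] -/
def γP (r : Fin N → Fin 2) : Matrix (Fin N → Leaf2) (Fin N → Leaf2) K :=
  Matrix.diagonal fun a => if (fun i => row (a i)) = r then 1 else 0

/-- **`(βP r, γP r)` intertwines the `y`-pencil of `(𝔖^♭)^{⊠N}`.** [folklore] -/
theorem hcomm_signStar_pow (r : Fin N → Fin 2) (c : Fin N → Leaf2) :
    βP K N r * slice (kroneckerPow (rot (signStar K)) N) c =
      slice (kroneckerPow (rot (signStar K)) N) c * γP K N r := by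
  ext b a
  rw [βP, γP, Matrix.diagonal_mul, Matrix.mul_diagonal, slice_apply, kroneckerPow_apply]
  simp only [rot_apply]
  by_cases h : (fun i => row (a i)) = fun i => (b i).1
  · rw [h, mul_comm]
  · obtain ⟨i, hi⟩ := Function.ne_iff.mp h
    rw [Finset.prod_eq_zero (Finset.mem_univ i) (signStar_eq_zero_of_row_ne K _ _ _ hi),
      mul_zero, zero_mul]

/-- The `2^N` projections `βP r` are linearly independent. [folklore] -/
theorem βP_linearIndependent : LinearIndependent K (βP K N) := by
  refine Fintype.linearIndependent_iff.mpr fun g hg r => ?_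
  have h := congr_fun (congr_fun hg (fun i => (r i, (0 : Fin 2)))) (fun i => (r i, (0 : Fin 2)))
  simpa [βP, Matrix.sum_apply, Matrix.diagonal_apply_eq] using h

end CommS

/-! ## The theorem -/

section Main
variable (K : Type u) [Field K]

/-- **`(𝔖^♭)^{⊠N} ⋭ (𝔖^♭ᵀ)^{⊠N}` for every `N ≥ 1`, over every field**: the `y`-pencil
commutant of `(𝔖^♭)^{⊠N}` contains `2^N` independent pairs, that of `(𝔖^♭ᵀ)^{⊠N}` only scalars,
and commutants only grow under degeneration (BCS (15.19)).
[cite: BurgisserClausenShokrollahi1997, (15.19), sec. 20.2] -/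
theorem signStar_pow_not_algDegeneratesTo_signTStar_pow (N : ℕ) (hN : 1 ≤ N) :
    ¬ AlgDegeneratesTo (kroneckerPow (signStar K) N) (kroneckerPow (signTStar K) N) := by
  intro h
  have h' : AlgDegeneratesTo (kroneckerPow (rot (signStar K)) N)
      (kroneckerPow (rot (signTStar K)) N) := algDegeneratesTo_rot h
  set x : Matrix (Fin N → Fin 2 × Fin 2) (Fin N → Fin 2 × Fin 2) K ×
      Matrix (Fin N → Leaf2) (Fin N → Leaf2) K := (1, 1) with hx
  refine not_algDegeneratesTo_of_commutant (R₀ := Fin N → Fin 2) _ _ (βP K N) (γP K N)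
    (hcomm_signStar_pow K N) (βP_linearIndependent K N) (K ∙ x) ?_ ?_ h'
  · intro β' γ' H
    obtain ⟨hb, hg⟩ := comm_signTStar_pow H
    rw [Submodule.mem_span_singleton]
    exact ⟨β' (fun _ => (0, 0)) (fun _ => (0, 0)), by rw [hx, Prod.smul_mk, ← hb, ← hg]⟩
  · calc Module.finrank K (K ∙ x) ≤ 1 := (finrank_span_le_card ({x} : Set _)).trans (by simp)
      _ < Fintype.card (Fin N → Fin 2) := by
        rw [Fintype.card_fun, Fintype.card_fin, Fintype.card_fin]
        exact Nat.one_lt_two_pow (by omega)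

/-- Nor does any power of `𝔖^♭` RESTRICT to the same power of `𝔖^♭ᵀ`. [folklore] -/
theorem signStar_pow_not_restrictsTo_signTStar_pow (N : ℕ) (hN : 1 ≤ N) :
    ¬ TensorRestrictsTo (kroneckerPow (signStar K) N) (kroneckerPow (signTStar K) N) :=
  fun h => signStar_pow_not_algDegeneratesTo_signTStar_pow K N hN h.algDegeneratesTo

/-- **Six antichain edges hold at every finite level `N ≥ 1`** (characteristic `≠ 2` for the
sign twists versus `⟨2,2,2⟩` and `𝔖^ᵀ` versus `𝔖^♭ᵀ`): `⟨2,2,2⟩^{⊠N} ⋭ (𝔖^♭)^{⊠N}, (𝔖^♭ᵀ)^{⊠N}`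
(rigidity), `(𝔖^ᵀ)^{⊠N} ⋭ (𝔖^♭)^{⊠N}, (𝔖^♭ᵀ)^{⊠N}` (full slice) and
`(𝔖^♭)^{⊠N} ⋭ (𝔖^♭ᵀ)^{⊠N}` (this file); the sixth, `⟨2,2,2⟩^{⊠N} ⋭ (𝔖^ᵀ)^{⊠N}`, is
`FarEdgeDescentTwistRigidity.matMul_pow_not_algDegeneratesTo_permStar_pow`.
[cite: BurgisserClausenShokrollahi1997, (15.19), sec. 20.2] -/
theorem allN_antichain_edges (h2 : (2 : K) ≠ 0) (N : ℕ) (hN : 1 ≤ N) :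
    ¬ AlgDegeneratesTo (kroneckerPow (matMulTensor K 2 2 (1 + 1)) N)
        (kroneckerPow (signStar K) N) ∧
    ¬ AlgDegeneratesTo (kroneckerPow (matMulTensor K 2 2 (1 + 1)) N)
        (kroneckerPow (signTStar K) N) ∧
    ¬ AlgDegeneratesTo (kroneckerPow (twistedStar K 2 1) N) (kroneckerPow (signStar K) N) ∧
    ¬ AlgDegeneratesTo (kroneckerPow (twistedStar K 2 1) N) (kroneckerPow (signTStar K) N) ∧
    ¬ AlgDegeneratesTo (kroneckerPow (signStar K) N) (kroneckerPow (signTStar K) N) :=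
  ⟨matMul_pow_not_algDegeneratesTo_signStar_pow K h2 N hN,
    matMul_pow_not_algDegeneratesTo_signTStar_pow K h2 N hN,
    twistedStar_pow_not_algDegeneratesTo_signStar N hN,
    twistedStar_pow_not_algDegeneratesTo_signTStar h2 N hN,
    signStar_pow_not_algDegeneratesTo_signTStar_pow K N hN⟩

end Main

end Summit.MatrixMultiplication.MatrixMultiplication.Theorems.FarEdgeDescentSignTwistCommPow

end
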